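import Mathlib
import Literature.NumberTheory.Transcendental.BlochWignerDilogarithm
import Literature.NumberTheory.Transcendental.BlochWignerDilogarithmProofs
import Literature.NumberTheory.Transcendental.PreBlochPlaces
import Literature.NumberTheory.Transcendental.PreBlochRogersProofs
import Literature.NumberTheory.Transcendental.BlochGroupRegulatorFiveTerm
import HarnessLib

/-!
# The distribution relations of the Bloch–Wigner dilogarithm

`D(xᴺ) = N · Σ_{m<N} D(ζᴺᵐ x)` for every `x ∈ ℂ`, `N ≥ 1`, `ζ_N = e^{2πi/N}` — the weight-2 distribution
("multiplication") relations of the single-valued dilogarithm `D = blochWignerDilog`, for ALL levels `N`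
(the tree had `N = 2`, `blochWignerDilog_sq`, and `N = 3`, `blochWignerDilog_cube`, by direct
differentiation).

The proof is algebraic: Dupont's distribution identity `{zᴺ} = N Σ_{j<N} {ζʲ z}` holds in the pre-Bloch
group `𝒫(F)` of any algebraically closed field of characteristic `0` (Dupont 2001, Cor. 8.15, from Rogers'
identity Thm. 8.14; tree: `PreBloch.distribution'`, file `PreBlochRogersProofs`), in particular in `𝒫(ℂ)`;
the Bloch–Wigner function kills the five-term relators (`PreBloch.regulator`, file
`BlochGroupRegulatorFiveTerm`), so applying the regulator `𝒫(ℂ) → ℝ`, `[z] ↦ D(z)`, to the identity of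
extended symbols (`⟦0⟧ = ⟦1⟧ = 0`, matching `D(0) = D(1) = 0`) gives the relation among values.

## References

* J. L. Dupont, *Scissors congruences, group homology and characteristic classes* (2001), Thm. 8.14,
  Cor. 8.15. [Dupont2001]
* D. Zagier, *The dilogarithm function* (2007), Ch. I §2 (functional equations; `Li₂(x²) = 2(Li₂(x) + Li₂(−x))`).
  [Zagier2007Dilogarithm]
-/

noncomputable section

open scoped BigOperators

namespace Literature.NumberTheory.Transcendental

/-- The regulator `𝒫(ℂ) → ℝ` at the identity embedding evaluates the extended symbol `⟦z⟧` to `D(z)`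
(for `z ∈ {0, 1}` both sides vanish). [folklore] -/
theorem PreBloch.regulator_id_sym (z : ℂ) :
    PreBloch.regulator (RingHom.id ℂ) (PreBloch.sym z) = blochWignerDilog z := by
  by_cases h : z ≠ 0 ∧ z ≠ 1
  · rw [PreBloch.sym_of_ne h, PreBloch.regulator_mk]
    rfl
  · rw [PreBloch.sym_of_not h, map_zero]
    rcases not_and_or.1 h with h0 | h1
    · rw [not_not.1 h0, blochWignerDilog_of_im_eq_zero (by simp)]
    · rw [not_not.1 h1, blochWignerDilog_of_im_eq_zero (by simp)]

/-- **Distribution relations of the Bloch–Wigner dilogarithm.** For `N ≥ 1`, `ζ = e^{2πi/N}` and every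
`x ∈ ℂ`: `D(xᴺ) = N · Σ_{m<N} D(ζᵐ x)`. Image under the regulator `[z] ↦ D(z)` of Dupont's identity
`{zᴺ} = N Σ {ζʲ z}` in `𝒫(ℂ)` (Cor. 8.15). [cite: Dupont2001, Cor. 8.15] -/
theorem blochWignerDilog_pow_distribution {N : ℕ} (hN : 0 < N) (x : ℂ) :
    blochWignerDilog (x ^ N) =
      N * ∑ m ∈ Finset.range N,
        blochWignerDilog (Complex.exp (2 * Real.pi * Complex.I / N) ^ m * x) := by
  have hζ := Complex.isPrimitiveRoot_exp N hN.ne'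
  have key := congrArg (PreBloch.regulator (RingHom.id ℂ)) (PreBloch.distribution' hN hζ x)
  rw [map_nsmul, map_sum] at key
  simp only [PreBloch.regulator_id_sym, nsmul_eq_mul] at key
  exact key

/-- The same with the primitive root as a parameter: for any primitive `N`-th root of unity `ζ ∈ ℂ`,
`D(xᴺ) = N · Σ_{m<N} D(ζᵐ x)`. [cite: Dupont2001, Cor. 8.15] -/
theorem blochWignerDilog_pow_distribution' {N : ℕ} (hN : 0 < N) {ζ : ℂ} (hζ : IsPrimitiveRoot ζ N)
    (x : ℂ) :
    blochWignerDilog (x ^ N) = N * ∑ m ∈ Finset.range N, blochWignerDilog (ζ ^ m * x) := by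
  have key := congrArg (PreBloch.regulator (RingHom.id ℂ)) (PreBloch.distribution' hN hζ x)
  rw [map_nsmul, map_sum] at key
  simp only [PreBloch.regulator_id_sym, nsmul_eq_mul] at key
  exact key

end Literature.NumberTheory.Transcendental

end
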